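import Mathlib.RingTheory.PowerSeries.Order
import Mathlib.RingTheory.PowerSeries.NoZeroDivisors
import Mathlib.Algebra.Polynomial.Identities
import Mathlib.Algebra.Polynomial.Derivative
import Mathlib.Algebra.Polynomial.Div
import Mathlib.Algebra.Polynomial.Eval.Degree
import Mathlib.Algebra.Field.Subfield.Basic
import HarnessLib

/-!
# The coefficients of a power-series root of a polynomial lie in a finitely generated field

Let `F` be a field, `L ⊆ F` a subfield and `p ∈ F⟦q⟧[Y]` a polynomial whose coefficients are power
series with all their coefficients in `L`. If `y ∈ F⟦q⟧` is a root of `p` at which `∂p/∂Y` does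
not vanish identically, `ord_q (∂p/∂Y)(y) = v`, then ALL coefficients of `y` lie in the field
generated over `L` by `y₀, …, y_v` (`coeff_mem_of_eval_eq_zero`): comparing the coefficients of
`q^{m+v}` in the Taylor expansion `0 = p(y_{<m}) + q^m z·(∂p/∂Y)(y_{<m}) + O(q^{2m})`,
`y = y_{<m} + q^m z`, gives the LINEAR recursion `D_v · y_m = −[q^{m+v}] p(y_{<m})` for `m > v`,
where `D_v ≠ 0` is the leading coefficient of `(∂p/∂Y)(y)`. In characteristic `0` every root of a
non-zero `p` is a root of some iterated derivative `∂ⁱp/∂Yⁱ` at which the next derivative does not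
vanish, so the coefficients of any power-series root of any non-zero `p` lie in a finitely
generated extension of `L` (`exists_coeff_mem_closure_of_eval_eq_zero`). The case `p = Y² − c`
(`coeff_mem_of_coeff_mul_self_mem`): if `y²` has coefficients in `L` and the lowest coefficient of
`y` lies in `L`, so do all coefficients of `y` (`char F ≠ 2`).

This is the formal ("Newton–Puiseux"/Hensel) finiteness behind the statement that the Fourier
coefficients of a modular form which is algebraic over `ℚ̄(λ)` generate a FINITE extension of `ℚ`
once they are algebraic (F. Calegari, V. Dimitrov, Y. Tang, *The unbounded denominators
conjecture*, J. Amer. Math. Soc. **38** (2025), arXiv:2109.09040, Remark 58: "we are reduced to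
the situation of a number field `K` such that `f(τ) ∈ O_K⟦q^{1/N}⟧`"); cf. the implicit function
theorem for formal power series, N. Bourbaki, *Algebra II*, Ch. IV §4 no. 7, and Hensel's lemma,
*Commutative Algebra* III §4.

## Contents (theorems only)

* `coeff_mul_mem`, `coeff_pow_mem`, `coeff_polynomial_eval_mem`,
  `coeff_coeff_derivative_mem`, `coeff_coeff_iterate_derivative_mem` — closure properties of
  "all coefficients in `L`";
* **`coeff_mem_of_eval_eq_zero`** — the recursion;
* `exists_iterate_derivative_eval` — reduction to a simple root of an iterated derivative
  (characteristic `0`);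
* **`exists_coeff_mem_closure_of_eval_eq_zero`** — coefficients of a root of `p ≠ 0` lie in
  `L(y₀, …, y_v)` for some `v`;
* `coeff_mem_of_coeff_mul_self_mem` — square roots.

## References

* [CalegariDimitrovTang2025] F. Calegari, V. Dimitrov, Y. Tang, J. Amer. Math. Soc. 38 (2025),
  arXiv:2109.09040, Remark 58 (the context of use).
* N. Bourbaki, *Algebra II*, Ch. IV §4 no. 7 (formal implicit functions); *Commutative Algebra*,
  Ch. III §4 (Hensel).
-/

namespace Literature.RingTheory.PowerSeries

variable {F : Type*} [Field F] {L : Subfield F}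

/-! ### Power series and polynomials with coefficients in a subfield -/

/-- Products of power series with coefficients in `L` have coefficients in `L`. [folklore] -/
theorem coeff_mul_mem {P Q : PowerSeries F} (hP : ∀ m, PowerSeries.coeff m P ∈ L)
    (hQ : ∀ m, PowerSeries.coeff m Q ∈ L) (m : ℕ) : PowerSeries.coeff m (P * Q) ∈ L := by
  rw [PowerSeries.coeff_mul]
  exact sum_mem fun p _ ↦ mul_mem (hP _) (hQ _)

/-- Powers of power series with coefficients in `L` have coefficients in `L`. [folklore] -/
theorem coeff_pow_mem {P : PowerSeries F} (hP : ∀ m, PowerSeries.coeff m P ∈ L) (n m : ℕ) :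
    PowerSeries.coeff m (P ^ n) ∈ L := by
  induction n generalizing m with
  | zero =>
    rw [pow_zero, PowerSeries.coeff_one]
    split_ifs
    exacts [one_mem L, zero_mem L]
  | succ n ih =>
    rw [pow_succ]
    exact coeff_mul_mem ih hP m

/-- Evaluating a polynomial whose coefficients have coefficients in `L` at a power series with
coefficients in `L` gives a power series with coefficients in `L`. [folklore] -/
theorem coeff_polynomial_eval_mem {p : Polynomial (PowerSeries F)} {y : PowerSeries F}
    (hp : ∀ n m, PowerSeries.coeff m (p.coeff n) ∈ L) (hy : ∀ m, PowerSeries.coeff m y ∈ L)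
    (m : ℕ) : PowerSeries.coeff m (p.eval y) ∈ L := by
  rw [Polynomial.eval_eq_sum_range, map_sum]
  exact sum_mem fun n _ ↦ coeff_mul_mem (hp n) (coeff_pow_mem hy n) m

/-- The `Y`-derivative preserves "coefficients in `L`". [folklore] -/
theorem coeff_coeff_derivative_mem {p : Polynomial (PowerSeries F)}
    (hp : ∀ n m, PowerSeries.coeff m (p.coeff n) ∈ L) (n m : ℕ) :
    PowerSeries.coeff m ((Polynomial.derivative p).coeff n) ∈ L := by
  rw [Polynomial.coeff_derivative, show (n + 1 : PowerSeries F) = ((n + 1 : ℕ) : PowerSeries F) by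
    push_cast; rfl, ← nsmul_eq_mul', map_nsmul]
  exact nsmul_mem (hp _ _) _

/-- Iterated `Y`-derivatives preserve "coefficients in `L`". [folklore] -/
theorem coeff_coeff_iterate_derivative_mem {p : Polynomial (PowerSeries F)}
    (hp : ∀ n m, PowerSeries.coeff m (p.coeff n) ∈ L) (i n m : ℕ) :
    PowerSeries.coeff m ((Polynomial.derivative^[i] p).coeff n) ∈ L := by
  induction i generalizing n m with
  | zero => exact hp n m
  | succ i ih =>
    rw [Function.iterate_succ_apply']
    exact coeff_coeff_derivative_mem ih n m

/-! ### The recursion -/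

/-- **Coefficients of a root with non-degenerate derivative.** Let `p ∈ F⟦q⟧[Y]` have
coefficients with coefficients in the subfield `L`, let `y ∈ F⟦q⟧` be a root of `p`, and let
`v = ord_q (∂p/∂Y)(y)` (the coefficients of `(∂p/∂Y)(y)` vanish below `v` and not at `v`). If
`y₀, …, y_v ∈ L` then every coefficient of `y` lies in `L`: for `m > v`, writing
`y = y_{<m} + q^m z`, the coefficient of `q^{m+v}` in
`0 = p(y_{<m}) + q^m z (∂p/∂Y)(y_{<m}) + O(q^{2m})` reads `D_v y_m = −[q^{m+v}] p(y_{<m})` with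
`D_v = [q^v](∂p/∂Y)(y) ≠ 0`, since `(∂p/∂Y)(y_{<m}) ≡ (∂p/∂Y)(y) (mod q^m)`.
[cite: CalegariDimitrovTang2025, Remark 58 (context); Bourbaki, Algebra II, IV §4 no. 7] -/
theorem coeff_mem_of_eval_eq_zero {p : Polynomial (PowerSeries F)} {y : PowerSeries F}
    (hp : ∀ n m, PowerSeries.coeff m (p.coeff n) ∈ L) (hy : p.eval y = 0) {v : ℕ}
    (hv : ∀ j < v, PowerSeries.coeff j ((Polynomial.derivative p).eval y) = 0)
    (hDv : PowerSeries.coeff v ((Polynomial.derivative p).eval y) ≠ 0)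
    (hinit : ∀ i ≤ v, PowerSeries.coeff i y ∈ L) (m : ℕ) : PowerSeries.coeff m y ∈ L := by
  induction m using Nat.strong_induction_on with
  | _ m ih =>
  rcases le_or_gt m v with hmv | hmv
  · exact hinit m hmv
  -- `y = y' + q^m z`
  set z : PowerSeries F := PowerSeries.mk fun i ↦ PowerSeries.coeff (m + i) y with hz
  set y' : PowerSeries F := y - PowerSeries.X ^ m * z with hy'
  have hyy' : y = y' + PowerSeries.X ^ m * z := (sub_add_cancel _ _).symm
  have hcy' : ∀ i, PowerSeries.coeff i y' = if i < m then PowerSeries.coeff i y else 0 := by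
    intro i
    rw [hy', map_sub, PowerSeries.coeff_X_pow_mul']
    split_ifs with h1 h2 h2
    · omega
    · rw [hz, PowerSeries.coeff_mk, Nat.add_sub_cancel' h1, sub_self]
    · rw [sub_zero]
    · omega
  have hy'L : ∀ i, PowerSeries.coeff i y' ∈ L := fun i ↦ by
    rw [hcy']
    split_ifs with h
    exacts [ih i h, zero_mem L]
  -- Taylor expansion at `y'`
  obtain ⟨kk, hk⟩ := Polynomial.binomExpansion p y' (PowerSeries.X ^ m * z)
  rw [← hyy', hy] at hk
  set D := (Polynomial.derivative p).eval y with hD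
  set D' := (Polynomial.derivative p).eval y' with hD'
  -- `D' ≡ D (mod q^m)`
  have hDD' : ∀ i < m, PowerSeries.coeff i D' = PowerSeries.coeff i D := by
    intro i hi
    obtain ⟨w, hw⟩ := Polynomial.sub_dvd_eval_sub y' y (Polynomial.derivative p)
    have e : y' - y = -(PowerSeries.X ^ m * z) := by rw [hy']; ring
    rw [e] at hw
    have h2 : PowerSeries.coeff i (D' - D) = 0 := by
      rw [hD', hD, hw, neg_mul, map_neg, mul_assoc, PowerSeries.coeff_X_pow_mul', if_neg (by omega),
        neg_zero]
    rwa [map_sub, sub_eq_zero] at h2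
  -- the coefficient of `q^{m+v}`
  have hcoef := congrArg (PowerSeries.coeff (m + v)) hk
  rw [map_zero, map_add, map_add] at hcoef
  have h3 : PowerSeries.coeff (m + v) (kk * (PowerSeries.X ^ m * z) ^ 2) = 0 := by
    have e : kk * (PowerSeries.X ^ m * z) ^ 2 = PowerSeries.X ^ (2 * m) * (kk * z ^ 2) := by ring
    rw [e, PowerSeries.coeff_X_pow_mul', if_neg (by omega)]
  have h2 : PowerSeries.coeff (m + v) (D' * (PowerSeries.X ^ m * z)) =
      PowerSeries.coeff v D * PowerSeries.coeff m y := by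
    have e : D' * (PowerSeries.X ^ m * z) = PowerSeries.X ^ m * (D' * z) := by ring
    rw [e, PowerSeries.coeff_X_pow_mul', if_pos (by omega), Nat.add_sub_cancel_left,
      PowerSeries.coeff_mul, Finset.Nat.sum_antidiagonal_eq_sum_range_succ
        (fun i j ↦ PowerSeries.coeff i D' * PowerSeries.coeff j z) v,
      Finset.sum_range_succ, Finset.sum_eq_zero fun i hi ↦ ?_, zero_add, Nat.sub_self, hz,
      PowerSeries.coeff_mk, add_zero, hDD' v hmv]
    have hi' : i < v := Finset.mem_range.mp hi
    rw [hDD' i (by omega), hv i hi', zero_mul]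
  rw [h2, h3, add_zero] at hcoef
  -- solve the linear equation for `y_m`
  have hDvL : PowerSeries.coeff v D ∈ L := by
    rw [← hDD' v hmv]
    exact coeff_polynomial_eval_mem (coeff_coeff_derivative_mem hp) hy'L v
  have hsolve : PowerSeries.coeff m y =
      -PowerSeries.coeff (m + v) (p.eval y') / PowerSeries.coeff v D := by
    rw [eq_div_iff hDv]
    linear_combination -hcoef
  rw [hsolve]
  exact div_mem (neg_mem (coeff_polynomial_eval_mem hp hy'L _)) hDvL

/-! ### Reduction to a simple root (characteristic `0`) -/

/-- In characteristic `0`, a root `y` of a non-zero `p ∈ F⟦q⟧[Y]` is a root of some iterated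
derivative `∂ⁱp/∂Yⁱ` at which `∂ⁱ⁺¹p/∂Yⁱ⁺¹` does not vanish (the `(deg p)`-th derivative is the
non-zero constant `(deg p)! · lead(p)`). [folklore] -/
theorem exists_iterate_derivative_eval [CharZero F] {p : Polynomial (PowerSeries F)} (hp0 : p ≠ 0)
    {y : PowerSeries F} (hy : p.eval y = 0) :
    ∃ i : ℕ, (Polynomial.derivative^[i] p).eval y = 0 ∧
      (Polynomial.derivative^[i + 1] p).eval y ≠ 0 := by
  classical
  have hd : 0 < p.natDegree := by
    by_contra h0
    have h0' : p.natDegree = 0 := by omega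
    rw [Polynomial.eq_C_of_natDegree_eq_zero h0', Polynomial.eval_C] at hy
    exact hp0 (by rw [Polynomial.eq_C_of_natDegree_eq_zero h0', hy, map_zero])
  have hex : ∃ i, (Polynomial.derivative^[i + 1] p).eval y ≠ 0 := by
    refine ⟨p.natDegree - 1, ?_⟩
    rw [Nat.sub_add_cancel hd]
    have hC : Polynomial.derivative^[p.natDegree] p =
        Polynomial.C (p.natDegree.factorial • p.leadingCoeff) := by
      ext n
      rw [Polynomial.coeff_iterate_derivative, Polynomial.coeff_C]
      split_ifs with hn
      · subst hn
        rw [zero_add, Nat.descFactorial_self, Polynomial.leadingCoeff]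
      · rw [Polynomial.coeff_eq_zero_of_natDegree_lt (by omega), smul_zero]
    rw [hC, Polynomial.eval_C, nsmul_eq_mul]
    refine mul_ne_zero (fun h0 ↦ ?_) (Polynomial.leadingCoeff_ne_zero.mpr hp0)
    have h1 := congrArg PowerSeries.constantCoeff h0
    rw [map_natCast, map_zero] at h1
    exact Nat.factorial_ne_zero _ (Nat.cast_eq_zero.mp h1)
  refine ⟨Nat.find hex, ?_, Nat.find_spec hex⟩
  by_cases h0 : Nat.find hex = 0
  · rw [h0]
    exact hy
  · have h1 := Nat.find_min hex (Nat.sub_one_lt h0)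
    rwa [Nat.sub_add_cancel (Nat.one_le_iff_ne_zero.mpr h0), not_ne_iff] at h1

/-- **Coefficients of a power-series root of a non-zero polynomial lie in a finitely generated
extension.** In characteristic `0`: if `p ∈ F⟦q⟧[Y]` is non-zero with coefficients having
coefficients in `L`, and `p(y) = 0`, then there is `v` such that every coefficient of `y` lies in
the subfield generated by `L` and `y₀, …, y_v`. [cite: CalegariDimitrovTang2025, Remark 58
(context); Bourbaki, Algebra II, IV §4 no. 7] -/
theorem exists_coeff_mem_closure_of_eval_eq_zero [CharZero F] {p : Polynomial (PowerSeries F)}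
    (hp0 : p ≠ 0) (hp : ∀ n m, PowerSeries.coeff m (p.coeff n) ∈ L) {y : PowerSeries F}
    (hy : p.eval y = 0) :
    ∃ v : ℕ, ∀ m, PowerSeries.coeff m y ∈
      Subfield.closure ((L : Set F) ∪ (fun i ↦ PowerSeries.coeff i y) '' Set.Iic v) := by
  classical
  obtain ⟨i, hi0, hi1⟩ := exists_iterate_derivative_eval hp0 hy
  have hp' : ∀ n m, PowerSeries.coeff m ((Polynomial.derivative^[i] p).coeff n) ∈ L :=
    coeff_coeff_iterate_derivative_mem hp i
  have hD : (Polynomial.derivative (Polynomial.derivative^[i] p)).eval y ≠ 0 := by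
    rwa [← Function.iterate_succ_apply' Polynomial.derivative i p]
  have hex : ∃ v, PowerSeries.coeff v
      ((Polynomial.derivative (Polynomial.derivative^[i] p)).eval y) ≠ 0 :=
    PowerSeries.exists_coeff_ne_zero_iff_ne_zero.mpr hD
  refine ⟨Nat.find hex, fun m ↦ ?_⟩
  set L' : Subfield F :=
    Subfield.closure ((L : Set F) ∪ (fun i ↦ PowerSeries.coeff i y) '' Set.Iic (Nat.find hex))
    with hL'
  have hLL' : ∀ x ∈ L, x ∈ L' := fun x hx ↦ Subfield.subset_closure (Or.inl hx)
  have hyL' : ∀ j ≤ Nat.find hex, PowerSeries.coeff j y ∈ L' := fun j hj ↦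
    Subfield.subset_closure (Or.inr ⟨j, hj, rfl⟩)
  have hv : ∀ j < Nat.find hex,
      PowerSeries.coeff j ((Polynomial.derivative (Polynomial.derivative^[i] p)).eval y) = 0 :=
    fun j hj ↦ by
      have := Nat.find_min hex hj
      rwa [not_ne_iff] at this
  exact coeff_mem_of_eval_eq_zero (L := L') (fun n m ↦ hLL' _ (hp' n m)) hi0 hv
    (Nat.find_spec hex) hyL' m

/-! ### Square roots -/

/-- **Coefficients of a square root.** If `char F ≠ 2`, `y ∈ F⟦q⟧` has lowest non-zero
coefficient `y_{n₀} ∈ L` and `y²` has all coefficients in `L`, then `y` has all coefficients in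
`L` (the case `p = Y² − y²` of `coeff_mem_of_eval_eq_zero`: `(∂p/∂Y)(y) = 2y` has order `n₀`).
[folklore] -/
theorem coeff_mem_of_coeff_mul_self_mem (h2 : (2 : F) ≠ 0) {y : PowerSeries F} {n₀ : ℕ}
    (hlt : ∀ i < n₀, PowerSeries.coeff i y = 0) (hn₀ : PowerSeries.coeff n₀ y ≠ 0)
    (hn₀L : PowerSeries.coeff n₀ y ∈ L) (hsq : ∀ m, PowerSeries.coeff m (y * y) ∈ L) (m : ℕ) :
    PowerSeries.coeff m y ∈ L := by
  set p : Polynomial (PowerSeries F) := Polynomial.X ^ 2 - Polynomial.C (y * y) with hpdef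
  have hp : ∀ n m, PowerSeries.coeff m (p.coeff n) ∈ L := by
    intro n m
    rw [hpdef, Polynomial.coeff_sub, Polynomial.coeff_X_pow, Polynomial.coeff_C, map_sub]
    refine sub_mem ?_ ?_
    · split_ifs
      · rw [PowerSeries.coeff_one]
        split_ifs
        exacts [one_mem L, zero_mem L]
      · rw [map_zero]
        exact zero_mem L
    · split_ifs
      · exact hsq m
      · rw [map_zero]
        exact zero_mem L
  have hy : p.eval y = 0 := by
    rw [hpdef, Polynomial.eval_sub, Polynomial.eval_pow, Polynomial.eval_X, Polynomial.eval_C,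
      pow_two, sub_self]
  have hD : (Polynomial.derivative p).eval y = y + y := by
    rw [hpdef, Polynomial.derivative_sub, Polynomial.derivative_C, sub_zero,
      Polynomial.derivative_X_pow, Polynomial.eval_mul, Polynomial.eval_C, Polynomial.eval_pow,
      Polynomial.eval_X]
    norm_num
    ring
  refine coeff_mem_of_eval_eq_zero hp hy (v := n₀) (fun j hj ↦ ?_) ?_ (fun i hi ↦ ?_) m
  · rw [hD, map_add, hlt j hj, add_zero]
  · rw [hD, map_add, ← two_mul]
    exact mul_ne_zero h2 hn₀
  · rcases hi.lt_or_eq with hi | rfl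
    · rw [hlt i hi]
      exact zero_mem L
    · exact hn₀L

end Literature.RingTheory.PowerSeries
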